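import Summits.ResolutionOfSingularities.ResolutionOfSingularities.Theorems.EquisingularLiftEquisingularLiftNatTowerInvTwoPointCentre
import Summits.ResolutionOfSingularities.ResolutionOfSingularities.Theorems.EquisingularLiftEquisingularLiftNatTowerReachTwoDefs
import Summits.ResolutionOfSingularities.ResolutionOfSingularities.Theorems.EquisingularLiftEquisingularLiftNatModelPointStep
import Summits.ResolutionOfSingularities.ResolutionOfSingularities.Theorems.EquisingularLiftEquisingularLiftNatModelPointStepOfSection
import Summits.ResolutionOfSingularities.ResolutionOfSingularities.Theorems.EquisingularLiftEquisingularLiftNatBlowupDisjointTransport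
import HarnessLib

/-!
# [OURS · L1 W4.5(b) · EL♮(3)] HSUB′(ReachTower₂) — THE (pt-reg) CLAUSE OF THE TOWER DRIVER AT `INV₁ := Tower.Inv₂`:
# `TowerPtReg₂ F₉ F₁₀ υ' (Tower.Inv₂ …)` modulo the ruled-datum transport stand-in `hRuled`
# (a point step at a NON-REGULAR point of the running curve where the fibre is REGULAR: blow up a SECTION through it)

res-D-pv-029 g8 (HSUB′(ReachTower)₃ ASSEMBLY; res-L1-w45b-plan-1 NAMING 2026-08-27T16:17:51Z «(pt-reg) = 029»). OURS; NOT a statement of any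
manuscript; AI-written, weaker than expert review. No `sorry`; standard axioms. DEF-FREE. `--supports stmt-ResolutionOfSingularities-20148 --as helper`.

WHAT. The (pt-reg) twin of res-L1-w45b-stub-4's …NatTowerPtRamInvTwo (p55xxxx), over THEIR centre-agnostic point-step lemmas
`Tower.inv₂_pointCentre_new / _transport / _forget` (…NatTowerInvTwoPointCentre): at a tower stage with `Tower.Inv₂ … G γ T E K` and a point
`y` of `V(closure T)_red` at which the curve is not regular but `G` is, the upstairs centre is the kernel of a SECTION `s : Spec O → X`
through `jG y` (res-D-pv-029 K3 `modelPointStep`: good reduction at a regular fibre point + Hensel), blown up by K3″ `modelPointStep_of_section`;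
its support meets the special fibre in `{jG y}` only, so every ideal sheaf not through `jG y` misses it (res-L1-w45b-stub-4 (E5)
`disjoint_support_of_inter_fibre_eq_singleton`). Output: the driver clause `Tower.towerPtReg₂_inv₂` (ONE theorem — the per-menu statements coincide in shape with stub-4's (pt-ram) ones and are
not re-declared: the stage step is built inline and the menus go to `Tower.inv₂_pointCentre_new / _forget / _transport`).
-/

set_option linter.dupNamespace false -- mandated namespace `Summit.<Summit>.<Problem>` of this single-conjunct summit
set_option linter.overlappingInstances false -- the binders carry `[IsDomain O] [IsDiscreteValuationRing O]`

noncomputable section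

open CategoryTheory CategoryTheory.Limits AlgebraicGeometry TopologicalSpace Topology IsLocalRing
open Literature.AlgebraicGeometry.Resolution
open AlgebraicGeometry.Scheme.IdealSheafData
open Summit.ResolutionOfSingularities.ResolutionOfSingularities.Theses.EquisingularLift.Split
open Summit.ResolutionOfSingularities.ResolutionOfSingularities.Cruxes.EquisingularLift.StrataSplit

namespace Summit.ResolutionOfSingularities.ResolutionOfSingularities.Cruxes.EquisingularLiftNat.Sections

/-- **THE (pt-reg) CLAUSE OF THE TOWER DRIVER AT `INV₁ := Tower.Inv₂`**: `TowerPtReg₂ F₉ F₁₀ υ' (Tower.Inv₂ O k θ P q Y Ch Ruled F₉ Z₉ hZ₉ F₁₀ υ')`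
modulo the ruled-datum transport hypothesis `hRuled` (interface `ruled_of_step_away`). Case split over the `TowerPtReg₂` menus.
[cite: Liu2002, §8.1 and Thm. 8.1.19] [cite: GortzWedhorn2020, Prop. 13.91 (3) and (13.19)] [OURS · L1 W4.5b · hypothesis (pt-reg) of
`hsub_reachTower₂_of_invariant` toward `stub_elnat_coneTowerPointResolution` (stmt-ResolutionOfSingularities-20148 / -20038); NOT a statement of
the manuscript] -/
theorem Tower.towerPtReg₂_inv₂ (O : Type) [CommRing O] [IsDomain O] [IsDiscreteValuationRing O] [IsAdicComplete (maximalIdeal O) O]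
    [IsAlgClosed (ResidueField O)] (k : Type) [Field k] (θ : O →+* k) (hθ : Function.Surjective θ)
    (P : Scheme.{0}) (q : P ⟶ Spec (.of O)) (Y : Set P) (hYsp : Y ⊆ q ⁻¹' {closedPoint O}) (hYirr : IsIrreducible Y)
    (hYcl : IsClosed Y) [IsProper q] (hPnoeth : IsLocallyNoetherian P) (hPreg : Scheme.IsRegular P)
    (Ch : ∀ X' : Scheme.{0}, (X' ⟶ P) → Set X' → Prop)
    (hChain : ∀ (X' : Scheme.{0}) (σ : X' ⟶ P) (S : Set X'), Ch X' σ S → Chain P Y X' σ S)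
    (hStep : ∀ (X' X'' : Scheme.{0}) (σ' : X' ⟶ P) (S' : Set X') (C : X'.IdealSheafData) (τ : X'' ⟶ X'),
      Ch X' σ' S' → IsBlowup τ C → Scheme.IsRegular C.subscheme → Flat (C.subschemeι ≫ σ' ≫ q) →
      σ' '' (C.support : Set X') ⊆ {x : P | ¬ IsGenericPoint x Y} →
      (C.support : Set X') ∩ (σ' ≫ q) ⁻¹' {closedPoint O} ⊆ S' →
      Ch X'' (τ ≫ σ') (closure (τ ⁻¹' (S' \ (C.support : Set X')))))
    (Ruled : Tower.RuledDatum P) (F₉ : Scheme.{0}) (Z₉ : Set F₉) (hZ₉ : IsClosed Z₉) (F₁₀ : Scheme.{0}) (υ' : F₁₀ ⟶ F₉)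
    (hRuled : ∀ (G₀ G₀' : Scheme.{0}) (γ₀ : G₀ ⟶ F₁₀) (E₀ : Set G₀) (X₀ X₀'' : Scheme.{0}) (σ₀ : X₀ ⟶ P) (j₀ : G₀ ⟶ X₀)
        (j₀' : G₀' ⟶ X₀'') (t₀' : G₀' ⟶ Spec (.of k)) (𝓔₀ : X₀.IdealSheafData) (τ₀ : X₀'' ⟶ X₀) (υ₀ : G₀' ⟶ G₀) (y₀ : G₀),
      j₀' ≫ τ₀ = υ₀ ≫ j₀ → IsPullback j₀' t₀' ((τ₀ ≫ σ₀) ≫ q) (Spec.map (CommRingCat.ofHom θ)) → y₀ ∉ E₀ →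
      (∃ e : (𝓔₀.comap τ₀).subscheme ≅ 𝓔₀.subscheme, e.hom ≫ 𝓔₀.subschemeι = (𝓔₀.comap τ₀).subschemeι ≫ τ₀) →
      Ruled F₉ Z₉ hZ₉ F₁₀ υ' G₀ γ₀ E₀ X₀ σ₀ j₀ 𝓔₀ →
      Ruled F₉ Z₉ hZ₉ F₁₀ υ' G₀' (υ₀ ≫ γ₀) (closure (υ₀ ⁻¹' (E₀ \ {y₀}))) X₀'' (τ₀ ≫ σ₀) j₀' (𝓔₀.comap τ₀)) :
    TowerPtReg₂ F₉ F₁₀ υ' (Tower.Inv₂ O k θ P q Y Ch Ruled F₉ Z₉ hZ₉ F₁₀ υ') := by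
  intro G G' γ T E K y υ₂ hyc K' E' hinv hTreg hGreg hυ₂ hK' hE'
  -- the (pt-reg) stage step: a section through `jG y` (K3), its kernel blown up (K3″), and the inputs of the centre-agnostic lemmas
  obtain ⟨X, σ, jG, C, X'', τ, j₂, t₂, hυ', hZ₉inf, hGint, hTirr, hEcl, hTE, hExc, hyc', hTy, hGnoeth, hXnoeth, hnoeth'', hτ, hdisj,
      hcomm, hCh'', hint'', hreg'', hdom'', hsq₂, hsets, hG'int, hT'irr⟩ :
      ∃ (X : Scheme.{0}) (σ : X ⟶ P) (jG : G ⟶ X) (C : X.IdealSheafData) (X'' : Scheme.{0}) (τ : X'' ⟶ X)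
      (j₂ : G' ⟶ X'') (t₂ : G' ⟶ Spec (.of k)),
      IsBlowup υ' (vanishingIdeal (⟨Z₉, hZ₉⟩ : Closeds F₉)) ∧ Z₉.Infinite ∧ IsIntegral G ∧ IsIrreducible T ∧ IsClosed E ∧ ¬ T ⊆ E ∧
      (∀ hE : IsClosed E, Tower.Exc₂ O P q Y Ruled Z₉ hZ₉ υ' G γ E hE K X σ jG) ∧
      IsClosed ({curvePt G T y} : Set G) ∧ ¬ T ⊆ {curvePt G T y} ∧ IsLocallyNoetherian G ∧ IsLocallyNoetherian X ∧
      IsLocallyNoetherian X'' ∧ IsBlowup τ C ∧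
      (∀ I : X.IdealSheafData, jG (curvePt G T y) ∉ (I.support : Set X) → Disjoint (I.support : Set X) (C.support : Set X)) ∧
      j₂ ≫ τ = υ₂ ≫ jG ∧ Ch X'' (τ ≫ σ) (closure (τ ⁻¹' ((jG '' T) \ (C.support : Set X)))) ∧ IsIntegral X'' ∧
      Scheme.IsRegular X'' ∧ IsDominant ((τ ≫ σ) ≫ q) ∧ IsPullback j₂ t₂ ((τ ≫ σ) ≫ q) (Spec.map (CommRingCat.ofHom θ)) ∧
      j₂ '' closure (υ₂ ⁻¹' (T \ {curvePt G T y})) = closure (τ ⁻¹' ((jG '' T) \ (C.support : Set X))) ∧ IsIntegral G' ∧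
      IsIrreducible (closure (υ₂ ⁻¹' (T \ {curvePt G T y}))) := by
      classical
      obtain ⟨hυ', hZ₉inf, hGint, hTcl, hTirr, hEcl, hTE, X, σ, S, jG, tG, hCh, hXint, hXnoeth, hXreg, hdom, hsq, hTS, hExc⟩ := hinv
      haveI := hGint
      haveI := hXint
      haveI := hXnoeth
      have hyT : curvePt G T y ∈ T := subschemeι_mem_of_isClosed hTcl y
      have hTy : ¬ T ⊆ {curvePt G T y} := not_subset_singleton_of_not_isRegularLocalRing_stalk y hTreg hyc
      obtain ⟨-, -, hσ⟩ := chain_isRegular P Y X σ S (hChain _ _ _ hCh) hPnoeth hPreg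
      haveI := hσ
      haveI hproper : IsProper (σ ≫ q) := inferInstance
      haveI : IsClosedImmersion (Spec.map (CommRingCat.ofHom θ)) := IsClosedImmersion.spec_of_surjective _ hθ
      haveI hjci : IsClosedImmersion jG := MorphismProperty.IsStableUnderBaseChange.of_isPullback hsq.flip inferInstance
      have hjyc : IsClosed ({jG (curvePt G T y)} : Set X) := by
        simpa only [Set.image_singleton] using hjci.isClosedEmbedding.isClosedMap _ hyc
      have hyoff : ¬ IsGenericPoint (σ (jG (curvePt G T y))) Y :=
        not_isGenericPoint_of_image_eq (hChain _ _ _ hCh) jG hjci.isClosedEmbedding.injective hTS hjyc hTy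
      have hjsp : (σ ≫ q) (jG (curvePt G T y)) = closedPoint O := by
        have h1 : jG (curvePt G T y) ∈ Set.range jG := ⟨_, rfl⟩
        rw [range_eq_preimage_of_isPullback hsq, range_specMap_of_surjective_of_field θ hθ] at h1
        exact h1
      haveI : IsLocallyNoetherian G := LocallyOfFiniteType.isLocallyNoetherian jG
      -- the section through `jG y` and the blow-up of its kernel (K3), then the model step with this section (K3″)
      obtain ⟨-, s, X'', τ, -, -, -, hs, hss₀, -, hτ, -, -, hnoeth'', -⟩ :=
        modelPointStep O k θ hθ P q Y hYsp Ch hStep X σ S hCh hXreg hproper hdom G jG tG hsq T hTS (curvePt G T y) hyc hGreg hyT hTy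
          hyoff G' υ₂ hυ₂
      haveI := hnoeth''
      obtain ⟨hCh'', hreg'', -, hint'', hdom'', hG'int, hT'irr, -, -, -, -, j₂, t₂, hsq₂, hcomm, -, hsets⟩ :=
        modelPointStep_of_section O k θ hθ P q Y hYsp hYirr hYcl Ch hChain hStep X σ S hCh hXreg hdom G jG tG hsq T hTS (curvePt G T y)
          hyc hyT hTy hyoff s hs hss₀ X'' τ hτ G' υ₂ hυ₂
      -- the centre meets the special fibre in `jG y` only
      obtain ⟨_, -, -, hCsupp⟩ := section_isClosedImmersion_and_isRegular_ker O X (σ ≫ q) s hs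
      have hCb : (s.ker.support : Set X) ∩ (σ ≫ q) ⁻¹' {closedPoint O} = {jG (curvePt G T y)} := by
        ext z
        constructor
        · rintro ⟨hz, hzsp⟩
          rw [hCsupp] at hz
          obtain ⟨p, rfl⟩ := hz
          have hp : p = closedPoint O := by
            have h1 : (s ≫ σ ≫ q) p = p := by rw [hs]; rfl
            rw [Scheme.Hom.comp_apply] at h1
            rw [← h1]; exact hzsp
          rw [Set.mem_singleton_iff, hp, hss₀]
        · rintro rfl
          refine ⟨?_, hjsp⟩
          rw [hCsupp, ← hss₀]; exact ⟨_, rfl⟩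
      have hdisj : ∀ I : X.IdealSheafData, jG (curvePt G T y) ∉ (I.support : Set X) →
          Disjoint (I.support : Set X) (s.ker.support : Set X) := fun I hI =>
        disjoint_support_of_inter_fibre_eq_singleton (σ ≫ q) s.ker I hCb hI
      subst hTS
      exact ⟨X, σ, jG, s.ker, X'', τ, j₂, t₂, hυ', hZ₉inf, hGint, hTirr, hEcl, hTE, hExc, hyc, hTy, inferInstance, hXnoeth, hnoeth'', hτ,
        hdisj, hcomm, hCh'', hint'', hreg'', hdom'', hsq₂, hsets, hG'int, hT'irr⟩
  haveI := hGint; haveI := hGnoeth; haveI := hXnoeth; haveI := hnoeth''; haveI := hint''; haveI := hG'int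
  have hD : ((vanishingIdeal (⟨{curvePt G T y}, hyc⟩ : Closeds G) : G.IdealSheafData).support : Set G) = {curvePt G T y} :=
    Scheme.IdealSheafData.coe_support_vanishingIdeal _
  rcases hE' with rfl | ⟨hside, rfl⟩
  · exact Tower.inv₂_pointCentre_new O k θ P q Y Ch Ruled hυ' hZ₉inf hyc' hTy hD hυ₂ hCh'' hreg'' hdom'' hsq₂ hsets hT'irr K'
  · have hE : Tower.NoRound υ' G γ E ∨ curvePt G T y ∉ E := hside
    rcases hK' with rfl | ⟨hyK, rfl⟩
    · exact Tower.inv₂_pointCentre_forget O k θ P q Y Ch Ruled hυ' hZ₉inf hTirr hEcl hTE hExc hyc' hTy hD hυ₂ hτ hdisj hcomm hCh''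
        hreg'' hdom'' hsq₂ hsets hT'irr hRuled hE
    · exact Tower.inv₂_pointCentre_transport O k θ P q Y Ch Ruled hυ' hZ₉inf hTirr hEcl hTE hExc hyc' hTy hD hυ₂ hτ hdisj hcomm hCh''
        hreg'' hdom'' hsq₂ hsets hT'irr hRuled hE (Or.inr hyK)

end Summit.ResolutionOfSingularities.ResolutionOfSingularities.Cruxes.EquisingularLiftNat.Sections

end
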